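import Summits.SmoothPoincare4.SmoothPoincare4.Theses.CongruenceShadows

/-!
# `ShadowApproximation` — negative-side support: standard finite shadows alone do not force `Iso`

Support lemmas for the crux `CongruenceShadows.ShadowApproximation` (stmt-SmoothPoincare4-14595),
from the standing disprover's work file `Cruxes/ShadowApproximation/Disproof.lean` (§3).

**`shadowApproximation_false_without_isGroupTrisection`.** The hypothesis `IsGroupTrisection`
cannot be dropped from the crux (nor weakened to "the `Kᵢ` are normal and slots `0, 1` are
literally standard"): at genus `3` the normal triple `J = (N₀, N₁, J₂)`, `J₂ = N₂ ⊓ ker θ ≤ N₂`,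
has ALL finite shadows standard — with the identity automorphism at every level and for every
finite-index NORMAL `M` (`Nᵢ ⊔ M = Jᵢ ⊔ M`, `junk_shadows`) — but `¬ Iso N J` (`not_iso_junk`).
Here `θ : S₃ →* Perm ℤ`, `b₀ ↦ (0 1 2)`, `b₁ ↦ (n ↦ n+1)`, other generators `↦ 1`; `θ(N₂)` is the
finitary alternating group of `ℤ`, which has no proper shift-invariant finite-index subgroup:
for `M ∋ b₁ᵀ` the commutator `w = b₀⁻¹ · b₁^{3T} b₀ b₁^{-3T} ∈ N₂ ⊓ M` has
`θ w = (0 1 2)⁻¹ (3T, 3T+1, 3T+2)`; conjugating by `h = (1 2)(-2 -1) = θ(s_h)` (inverts `(0 1 2)`,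
disjoint from the far cycle) and dividing gives `(0 1 2)² ∈ θ(N₂ ⊓ M)`, so `N₂ ≤ J₂ ⊔ M`.
Non-isomorphism: the class of `b₀` in `S₃ ⧸ J₂` has order `3`, while `S₃ ⧸ N₂ ≅ F₃` is torsion-free.
Moral: a proof of the crux must use the free-quotient / pair-quotient conditions (residual
finiteness of `S ⧸ Kᵢ`), not only congruence data — shadows are blind to perfect locally finite
sections (complementing the planner's unit-twist finding, where the rival triples ARE handlebody
triples).
-/

noncomputable section

namespace Summit.SmoothPoincare4.SmoothPoincare4.Theorems.ShadowApproximation.Negative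

set_option linter.dupNamespace false

open Literature.Topology.FourManifolds
open Summit.SmoothPoincare4.SmoothPoincare4.Theses.CongruenceShadows

/-- The genus-3 surface group `S₃`. [folklore] -/
abbrev S : Type := SurfaceGroup 3

/-! ## Finitary permutations of `ℤ`: the 3-cycles `(j, j+1, j+2)` and the shift -/

/-- The 3-cycle `j ↦ j+1 ↦ j+2 ↦ j` on `ℤ`. [folklore] -/
def cycAt (j : ℤ) : Equiv.Perm ℤ := Equiv.swap j (j + 1) * Equiv.swap (j + 1) (j + 2)

/-- The 3-cycle `(0 1 2)`. [folklore] -/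
def cyc : Equiv.Perm ℤ := cycAt 0

/-- The shift `n ↦ n + 1`. [folklore] -/
def shift : Equiv.Perm ℤ := Equiv.addRight (1 : ℤ)

/-- The even permutation `h = (1 2)(-2 -1) = (-2 -1 0)(-1 0 1)(0 1 2)`. [folklore] -/
def hPerm : Equiv.Perm ℤ := cycAt (-2) * cycAt (-1) * cycAt 0

/-- Pointwise formula for the 3-cycle `(j, j+1, j+2)`. [folklore] -/
theorem cycAt_apply (j x : ℤ) :
    cycAt j x = if x = j then j + 1 else if x = j + 1 then j + 2 else if x = j + 2 then j else x := by
  simp only [cycAt, Equiv.Perm.mul_apply, Equiv.swap_apply_def]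
  split_ifs <;> omega

/-- Pointwise formula for `(0 1 2)`. [folklore] -/
theorem cyc_apply (x : ℤ) :
    cyc x = if x = 0 then 1 else if x = 1 then 2 else if x = 2 then 0 else x := by
  simp only [cyc, cycAt_apply]
  split_ifs <;> omega

/-- `(0 1 2)` is not the identity. [folklore] -/
theorem cyc_ne_one : cyc ≠ 1 := by
  intro h
  have := congrArg (fun f : Equiv.Perm ℤ => f 0) h
  simp [cyc_apply] at this

/-- `(0 1 2)³ = 1`. [folklore] -/
theorem cyc_pow_three : cyc ^ 3 = 1 := by
  ext x
  simp only [pow_succ, pow_zero, one_mul, Equiv.Perm.mul_apply, Equiv.Perm.one_apply, cyc_apply]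
  split_ifs <;> omega

/-- `h (0 1 2) h⁻¹ = (0 1 2)⁻¹`, written as `h (0 1 2) = (0 1 2)² h` (checked pointwise: on the
window `[-2, 2]` by evaluation, outside it every letter fixes `x`). [folklore] -/
theorem hPerm_mul_cyc : hPerm * cyc = cyc * cyc * hPerm := by
  ext x
  by_cases hx : -2 ≤ x ∧ x ≤ 2
  · obtain ⟨h1, h2⟩ := hx
    interval_cases x <;> decide
  · simp (disch := omega) [hPerm, cyc, cycAt, Equiv.Perm.mul_apply, Equiv.swap_apply_of_ne_of_ne]

/-- `h` fixes every `x ≥ 3`. [folklore] -/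
theorem hPerm_apply_of_le {x : ℤ} (hx : 3 ≤ x) : hPerm x = x := by
  simp (disch := omega) [hPerm, cycAt, Equiv.Perm.mul_apply, Equiv.swap_apply_of_ne_of_ne]

/-- `(k, k+1, k+2)` fixes every `x ≤ 2` when `k ≥ 3`. [folklore] -/
theorem cycAt_apply_of_le {k x : ℤ} (hk : 3 ≤ k) (hx : x ≤ 2) : cycAt k x = x := by
  simp (disch := omega) [cycAt, Equiv.Perm.mul_apply, Equiv.swap_apply_of_ne_of_ne]

/-- `h` is disjoint from every 3-cycle `(k, k+1, k+2)` with `k ≥ 3`. [folklore] -/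
theorem disjoint_hPerm_cycAt {k : ℤ} (hk : 3 ≤ k) : Equiv.Perm.Disjoint hPerm (cycAt k) := fun x => by
  by_cases hx : x ≤ 2
  exacts [Or.inr (cycAt_apply_of_le hk hx), Or.inl (hPerm_apply_of_le (by omega))]

/-- Conjugating `(0 1 2)` by the shift by `j` gives `(j, j+1, j+2)`. [folklore] -/
theorem shift_conj_cyc (j : ℤ) :
    Equiv.addRight j * cyc * (Equiv.addRight j)⁻¹ = cycAt j := by
  ext x
  simp only [Equiv.Perm.mul_apply, Equiv.Perm.inv_def, Equiv.addRight_symm, Equiv.coe_addRight,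
    cyc_apply, cycAt_apply]
  split_ifs <;> omega

/-! ## The junk homomorphism `θ : S₃ →* Perm ℤ` -/

/-- Generator images: `b₀ ↦ (0 1 2)`, `b₁ ↦ shift`, all other generators `↦ 1`. [folklore] -/
def thetaGen (p : surfaceGen 3) : Equiv.Perm ℤ :=
  if p = ((0 : Fin 3), true) then cyc else if p = ((1 : Fin 3), true) then shift else 1

/-- The genus-3 relator spelled out. [folklore] -/
theorem surfaceRelator_three : surfaceRelator 3 =
    genA 0 * genB 0 * (genA 0)⁻¹ * (genB 0)⁻¹ * (genA 1 * genB 1 * (genA 1)⁻¹ * (genB 1)⁻¹ *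
      (genA 2 * genB 2 * (genA 2)⁻¹ * (genB 2)⁻¹)) := by
  simp [surfaceRelator, List.finRange_succ]

/-- `θ` kills the surface relator (each commutator `[aᵢ, bᵢ]` has `θ aᵢ = 1`). [folklore] -/
theorem lift_thetaGen_surfaceRelator : FreeGroup.lift thetaGen (surfaceRelator 3) = 1 := by
  rw [surfaceRelator_three]
  simp [genA, genB, thetaGen]

/-- **The junk homomorphism** `θ : S₃ →* Perm ℤ`. [folklore] -/
def theta : S →* Equiv.Perm ℤ :=
  PresentedGroup.toGroup (f := thetaGen) (by
    intro r hr
    rw [Set.mem_singleton_iff] at hr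
    subst hr
    exact lift_thetaGen_surfaceRelator)

/-- `θ` on a generator. [folklore] -/
@[simp] theorem theta_of (p : surfaceGen 3) : theta (PresentedGroup.of p) = thetaGen p :=
  PresentedGroup.toGroup.of _

/-- `θ aᵢ = 1`. [folklore] -/
@[simp] theorem theta_a (i : Fin 3) : theta (SurfaceGroup.a i) = 1 := by
  fin_cases i <;> simp [SurfaceGroup.a, thetaGen]

/-- `θ b₀ = (0 1 2)`. [folklore] -/
@[simp] theorem theta_b0 : theta (SurfaceGroup.b 0) = cyc := by
  simp [SurfaceGroup.b, thetaGen]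

/-- `θ b₁ =` shift. [folklore] -/
@[simp] theorem theta_b1 : theta (SurfaceGroup.b 1) = shift := by
  simp [SurfaceGroup.b, thetaGen]

/-- `θ b₂ = 1`. [folklore] -/
@[simp] theorem theta_b2 : theta (SurfaceGroup.b 2) = 1 := by
  simp [SurfaceGroup.b, thetaGen]

/-- The word `s_h = (b₁⁻² b₀ b₁²)(b₁⁻¹ b₀ b₁) b₀` with `θ s_h = h`. [folklore] -/
def sh : S :=
  ((SurfaceGroup.b 1)⁻¹ * (SurfaceGroup.b 1)⁻¹ * SurfaceGroup.b 0 * SurfaceGroup.b 1 * SurfaceGroup.b 1) *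
    ((SurfaceGroup.b 1)⁻¹ * SurfaceGroup.b 0 * SurfaceGroup.b 1) * SurfaceGroup.b 0

/-- `θ s_h = h` (pointwise: evaluation on `[-2, 2]`, every letter fixes `x` outside). [folklore] -/
theorem theta_sh : theta sh = hPerm := by
  have e : theta sh =
      shift⁻¹ * shift⁻¹ * cyc * shift * shift * (shift⁻¹ * cyc * shift) * cyc := by
    simp only [sh, map_mul, map_inv, theta_b0, theta_b1]
  rw [e]
  ext x
  by_cases hx : -2 ≤ x ∧ x ≤ 2
  · obtain ⟨h1, h2⟩ := hx
    interval_cases x <;> decide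
  · simp (disch := omega) [hPerm, cyc, cycAt, shift, Equiv.Perm.mul_apply, Equiv.Perm.inv_def,
      Equiv.addRight_symm, Equiv.swap_apply_of_ne_of_ne]

/-! ## The junk triple -/

/-- The standard genus-3 kernels are normal. [folklore] -/
instance s4Kernels_normal (i : Fin 3) : (s4Kernels i).Normal :=
  s4Kernels_isGroupTrisection_holds.normal i

/-- **The junk third kernel** `J₂ = N₂ ⊓ ker θ`. [folklore] -/
def J2 : Subgroup S := s4Kernels 2 ⊓ theta.ker

/-- `J₂` is normal (intersection of normal subgroups). [folklore] -/
instance J2_normal : J2.Normal := by unfold J2; infer_instance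

/-- **The junk triple** `J = (N₀, N₁, N₂ ⊓ ker θ)`. [folklore] -/
def junk : TrisectionKernels 3 := ![s4Kernels 0, s4Kernels 1, J2]

/-- Slot `0` of the junk triple is standard. [folklore] -/
@[simp] theorem junk_zero : junk 0 = s4Kernels 0 := rfl
/-- Slot `1` of the junk triple is standard. [folklore] -/
@[simp] theorem junk_one : junk 1 = s4Kernels 1 := rfl
/-- Slot `2` of the junk triple is `J₂`. [folklore] -/
@[simp] theorem junk_two : junk 2 = J2 := rfl

/-- `J₂ ≤ N₂`. [folklore] -/
theorem J2_le : J2 ≤ s4Kernels 2 := inf_le_left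

/-- The junk kernels are normal. [folklore] -/
theorem junk_normal (i : Fin 3) : (junk i).Normal := by
  fin_cases i <;> simp <;> infer_instance

/-- `b₀ ∈ N₂`. [folklore] -/
theorem b0_mem_N2 : SurfaceGroup.b 0 ∈ s4Kernels 2 := of_mem_s4Kernels 2 (by decide)

/-- `b₀ ∉ J₂` (`θ b₀ = (0 1 2) ≠ 1`). [folklore] -/
theorem b0_not_mem_J2 : SurfaceGroup.b 0 ∉ J2 := by
  intro h
  have h' : theta (SurfaceGroup.b 0) = 1 := (MonoidHom.mem_ker).1 h.2
  exact cyc_ne_one (by simpa using h')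

/-- `b₀³ ∈ J₂` (`(0 1 2)³ = 1`). [folklore] -/
theorem b0_pow_three_mem_J2 : SurfaceGroup.b 0 ^ 3 ∈ J2 := by
  refine Subgroup.mem_inf.2 ⟨Subgroup.pow_mem _ b0_mem_N2 3, ?_⟩
  rw [MonoidHom.mem_ker, map_pow, theta_b0, cyc_pow_three]

/-! ## The shadows of `J₂` are those of `N₂` -/

section shadows

variable (M : Subgroup S) [M.Normal] [M.FiniteIndex]

omit [M.FiniteIndex] in
/-- The image `U = θ(N₂ ⊓ M)` is invariant under conjugation by `θ(S₃)`. [folklore] -/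
theorem conj_mem_image (s : S) {p : Equiv.Perm ℤ} (hp : p ∈ (s4Kernels 2 ⊓ M).map theta) :
    theta s * p * (theta s)⁻¹ ∈ (s4Kernels 2 ⊓ M).map theta := by
  obtain ⟨w, hw, rfl⟩ := hp
  refine ⟨s * w * s⁻¹, ?_, by simp [map_mul, map_inv]⟩
  exact (inferInstance : (s4Kernels 2 ⊓ M).Normal).conj_mem w hw s

/-- KEY STEP: the 3-cycle `(0 1 2) = θ b₀` lies in `θ(N₂ ⊓ M)`. [folklore] -/
theorem cyc_mem_image : cyc ∈ (s4Kernels 2 ⊓ M).map theta := by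
  -- the far 3-cycle: k = 3 · [S : M] ≥ 3, u = b₁ᵏ ∈ M
  have hidx : M.index ≠ 0 := Subgroup.FiniteIndex.index_ne_zero
  set k : ℕ := 3 * M.index with hk
  have hk3 : (3 : ℤ) ≤ (k : ℤ) := by omega
  have hu : SurfaceGroup.b 1 ^ k ∈ M := by
    rw [hk, pow_mul']
    exact Subgroup.pow_mem _ (Subgroup.pow_index_mem M _) 3
  set u : S := SurfaceGroup.b 1 ^ k with hu_def
  have hθu : theta u = Equiv.addRight (k : ℤ) := by
    rw [hu_def, map_pow, theta_b1, shift, Equiv.nsmul_addRight]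
    simp
  -- w = b₀⁻¹ (u b₀ u⁻¹) ∈ N₂ ⊓ M, θ w = cyc⁻¹ * cycAt k
  have hwN : (SurfaceGroup.b 0)⁻¹ * (u * SurfaceGroup.b 0 * u⁻¹) ∈ s4Kernels 2 :=
    Subgroup.mul_mem _ (Subgroup.inv_mem _ b0_mem_N2)
      ((inferInstance : (s4Kernels 2).Normal).conj_mem _ b0_mem_N2 u)
  have hwM : (SurfaceGroup.b 0)⁻¹ * (u * SurfaceGroup.b 0 * u⁻¹) ∈ M := by
    have h1 : (SurfaceGroup.b 0)⁻¹ * u * (SurfaceGroup.b 0)⁻¹⁻¹ ∈ M :=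
      (inferInstance : M.Normal).conj_mem u hu _
    have h2 : u⁻¹ ∈ M := Subgroup.inv_mem _ hu
    have := Subgroup.mul_mem _ h1 h2
    simpa [mul_assoc] using this
  have hv : cyc⁻¹ * cycAt k ∈ (s4Kernels 2 ⊓ M).map theta := by
    refine ⟨_, ⟨hwN, hwM⟩, ?_⟩
    rw [map_mul, map_inv, theta_b0, map_mul, map_mul, map_inv, hθu, theta_b0, shift_conj_cyc]
  -- conjugate by h = θ s_h: h (cyc⁻¹ cycAt k) h⁻¹ = cyc * cycAt k
  have hcomm : hPerm * cycAt k = cycAt k * hPerm := (disjoint_hPerm_cycAt hk3).commute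
  have hinv : hPerm * cyc⁻¹ = cyc * hPerm := by
    have h3 : cyc * cyc * cyc = 1 := by rw [← cyc_pow_three]; simp [pow_succ]
    calc hPerm * cyc⁻¹ = cyc * cyc * cyc * hPerm * cyc⁻¹ := by rw [h3, one_mul]
      _ = cyc * (hPerm * cyc) * cyc⁻¹ := by rw [hPerm_mul_cyc]; simp [mul_assoc]
      _ = cyc * hPerm := by simp [mul_assoc]
  have hv' : cyc * cycAt k ∈ (s4Kernels 2 ⊓ M).map theta := by
    have := conj_mem_image M sh hv
    rw [theta_sh] at this
    have e : hPerm * (cyc⁻¹ * cycAt ↑k) * hPerm⁻¹ = cyc * cycAt k := by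
      calc hPerm * (cyc⁻¹ * cycAt ↑k) * hPerm⁻¹ = (hPerm * cyc⁻¹) * cycAt k * hPerm⁻¹ := by
            simp [mul_assoc]
        _ = cyc * (hPerm * cycAt k) * hPerm⁻¹ := by rw [hinv]; simp [mul_assoc]
        _ = cyc * cycAt k := by rw [hcomm]; simp [mul_assoc]
    rwa [e] at this
  -- divide: (cyc * c)(cyc⁻¹ * c)⁻¹ = cyc², and cyc = (cyc²)²
  have hsq : cyc * cyc ∈ (s4Kernels 2 ⊓ M).map theta := by
    have := Subgroup.mul_mem _ hv' (Subgroup.inv_mem _ hv)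
    simpa [mul_assoc] using this
  have h4 : cyc = cyc * cyc * (cyc * cyc) := by
    have h3 : cyc ^ 3 = 1 := cyc_pow_three
    calc cyc = cyc ^ 3 * cyc := by rw [h3, one_mul]
      _ = cyc * cyc * (cyc * cyc) := by simp [pow_succ, mul_assoc]
  rw [h4]
  exact Subgroup.mul_mem _ hsq hsq

/-- Hence `θ(N₂) ≤ θ(N₂ ⊓ M)`: the preimage of `θ(N₂ ⊓ M)` is a normal subgroup of `S₃`
containing the normal generators `b₀, a₁, a₂` of `N₂`. [folklore] -/
theorem N2_le_comap_image : s4Kernels 2 ≤ ((s4Kernels 2 ⊓ M).map theta).comap theta := by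
  haveI : (((s4Kernels 2 ⊓ M).map theta).comap theta).Normal :=
    ⟨fun x hx s => by
      rw [Subgroup.mem_comap] at hx ⊢
      simpa [map_mul, map_inv] using conj_mem_image M s hx⟩
  refine le_trans (le_of_eq (s4Kernels_eq 2)) (Subgroup.normalClosure_le_normal ?_)
  rintro _ ⟨p, hp, rfl⟩
  have hp' : p ∈ s4Gens 2 := hp
  rw [SetLike.mem_coe, Subgroup.mem_comap, theta_of]
  obtain ⟨i, b⟩ := p
  fin_cases i <;> cases b <;>
    first
    | exact absurd hp' (by decide)
    | simp [thetaGen, cyc_mem_image M]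

/-- **Standard shadows of the junk kernel**: `N₂ ⊔ M = J₂ ⊔ M` for every finite-index normal `M`.
[folklore] -/
theorem N2_sup_eq_J2_sup : s4Kernels 2 ⊔ M = J2 ⊔ M := by
  apply le_antisymm
  · refine sup_le ?_ le_sup_right
    intro x hx
    obtain ⟨w, ⟨hwN, hwM⟩, hθ⟩ := N2_le_comap_image M hx
    have hxw : x * w⁻¹ ∈ J2 := by
      refine Subgroup.mem_inf.2 ⟨Subgroup.mul_mem _ hx (Subgroup.inv_mem _ hwN), ?_⟩
      rw [MonoidHom.mem_ker, map_mul, map_inv, ← hθ, mul_inv_cancel]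
    have : x = x * w⁻¹ * w := by group
    rw [this]
    exact Subgroup.mul_mem_sup hxw hwM
  · exact sup_le_sup_right J2_le M

/-- All three shadows of the junk triple are standard, with the identity automorphism. [folklore] -/
theorem junk_shadows (i : Fin 3) : s4Kernels i ⊔ M = junk i ⊔ M := by
  fin_cases i
  · rfl
  · rfl
  · exact N2_sup_eq_J2_sup M

end shadows

/-! ## The junk triple is not isomorphic to the standard one -/

/-- `S₃ ⧸ N₂` is torsion-free (it is the free group on the three surviving generators). [folklore] -/
theorem quotient_N2_pow_eq_one {q : S ⧸ s4Kernels 2} {n : ℕ} (hn : n ≠ 0) (h : q ^ n = 1) : q = 1 := by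
  let e : S ⧸ s4Kernels 2 ≃* FreeGroup {x // x ∉ s4Gens 2} :=
    quotientEquivFreeGroupErase (s4Gens 2) (s4Gens_hits 2) (s4Kernels 2)
      (fun _ hx => of_mem_s4Kernels 2 hx) (s4Kernels_le_ker _ _ 2 le_rfl)
  have h' : e q ^ n = 1 := by rw [← map_pow, h, map_one]
  have : e q = 1 := (pow_eq_one_iff_left hn).1 h'
  simpa using congrArg e.symm this

/-- **The junk triple is not isomorphic to `N = s4Kernels`**: an isomorphism would give
`S₃ ⧸ N₂ ≃* S₃ ⧸ J₂`, but the class of `b₀` in `S₃ ⧸ J₂` is a non-trivial element of order `3`.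
[folklore] -/
theorem not_iso_junk : ¬ TrisectionKernels.Iso s4Kernels junk := by
  rintro ⟨α, hα⟩
  have h2 : (s4Kernels 2).map (α : S →* S) = J2 := by simpa using hα 2
  let e : S ⧸ s4Kernels 2 ≃* S ⧸ J2 := QuotientGroup.congr (s4Kernels 2) J2 α h2
  set q : S ⧸ J2 := QuotientGroup.mk (SurfaceGroup.b 0) with hq
  have hq3 : q ^ 3 = 1 := by
    rw [hq, ← QuotientGroup.mk_pow, QuotientGroup.eq_one_iff]
    exact b0_pow_three_mem_J2
  have hq1 : q ≠ 1 := by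
    rw [hq, Ne, QuotientGroup.eq_one_iff]
    exact b0_not_mem_J2
  have : e.symm q = 1 :=
    quotient_N2_pow_eq_one three_ne_zero (by rw [← map_pow, hq3, map_one])
  exact hq1 (by simpa using congrArg e this)

/-! ## Conclusions -/

/-- **Standard shadows alone do not force `Iso` (genus 3).** Even for NORMAL triples with two
slots literally standard, the third contained in the standard one, and level-wise EQUAL shadows
for every finite-index normal subgroup. [folklore] -/
theorem not_iso_of_shadows_only :
    ¬ ∀ K : TrisectionKernels 3, (∀ i, (K i).Normal) → K 0 = s4Kernels 0 → K 1 = s4Kernels 1 →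
      K 2 ≤ s4Kernels 2 →
      (∀ M : Subgroup S, M.Normal → M.FiniteIndex → ∀ i : Fin 3, s4Kernels i ⊔ M = K i ⊔ M) →
      TrisectionKernels.Iso s4Kernels K := by
  intro h
  exact not_iso_junk (h junk junk_normal rfl rfl J2_le (fun M hM hF i => by
    haveI := hM; haveI := hF; exact junk_shadows M i))

/-- **LOAD-BEARING: `IsGroupTrisection` cannot be dropped from `ShadowApproximation`.** The crux
(stmt-SmoothPoincare4-14595) with `IsGroupTrisection` and the Waldhausen normalisation `hW` removed,
keeping only normality of the kernels and the standard-shadow hypothesis VERBATIM, is false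
(at `m = 0`, by the junk triple `(N₀, N₁, N₂ ⊓ ker θ)`). [folklore] -/
theorem shadowApproximation_false_without_isGroupTrisection :
    ¬ ∀ (m : ℕ) (K : TrisectionKernels (3 + 3 * m)), (∀ i, (K i).Normal) →
      (∀ M : Subgroup (SurfaceGroup (3 + 3 * m)), M.Characteristic → M.FiniteIndex →
        ∃ ψ : SurfaceGroup (3 + 3 * m) ≃* SurfaceGroup (3 + 3 * m), ∀ i : Fin 3,
          (s4Kernels.stabilizeIter m i ⊔ M).map ψ.toMonoidHom = K i ⊔ M) →
      TrisectionKernels.Iso (s4Kernels.stabilizeIter m) K := by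
  intro h
  refine not_iso_junk (h 0 junk junk_normal fun M hM hF => ⟨MulEquiv.refl _, fun i => ?_⟩)
  haveI := hM
  haveI := hF
  haveI : M.Normal := inferInstance
  change (s4Kernels i ⊔ M).map (MulEquiv.refl S).toMonoidHom = junk i ⊔ M
  simpa using junk_shadows M i

/-- The same with the Waldhausen normalisation of the pair `(0,1)` retained literally
(`K 0 = N 0`, `K 1 = N 1`): still false — so on the load path the free-quotient conditions of
slot `2` and of the pairs `(0,2)`, `(1,2)` are what a proof must use. [folklore] -/
theorem shadowApproximation_false_without_isGroupTrisection' :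
    ¬ ∀ (K : TrisectionKernels 3), (∀ i, (K i).Normal) → K 0 = s4Kernels 0 → K 1 = s4Kernels 1 →
      (∀ M : Subgroup (SurfaceGroup 3), M.Characteristic → M.FiniteIndex →
        ∃ ψ : SurfaceGroup 3 ≃* SurfaceGroup 3, ∀ i : Fin 3,
          (s4Kernels i ⊔ M).map ψ.toMonoidHom = K i ⊔ M) →
      TrisectionKernels.Iso s4Kernels K := by
  intro h
  refine not_iso_junk (h junk junk_normal rfl rfl fun M hM hF => ⟨MulEquiv.refl _, fun i => ?_⟩)
  haveI := hM
  haveI := hF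
  haveI : M.Normal := inferInstance
  simpa using junk_shadows M i

end Summit.SmoothPoincare4.SmoothPoincare4.Theorems.ShadowApproximation.Negative

end
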